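import Mathlib
import Summits.QuantumAdvantage.QuantumAdvantage.Theses.MobiusLadder
import Literature.NumberTheory.Sieve.BourgainSarnakZieglerCriterion
import Literature.NumberTheory.LFunctions.SemimultiplicativeMoebius

/-!
# Sketch (crux-ideate, ideator 2) for crux `QuadraticDigitPhases` (item stmt-QuantumAdvantage-1391)

First lemmas of three idea cards, stated over existing declarations (signatures only; `sorry`
bodies are placeholders — this file only has to ELABORATE).

* Card `carry-cocycle-katai`: `testBit_mul_odd` (the dilation cocycle identity),
  `kbszSum`, `HasSeparatedMatching`, `LongRangeKbszDecay`, `longRange_case`,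
  `IsBanded`, `BandedQuadraticDigitPhases`, `crux_of_banded_and_longRange`.
* Card `dyadic-block-bsz`: `cutBound` (the cut inequality), `DigitalUniformDyadicBlocks`,
  `crux_of_blockUniformity`.
* Card `banded-compactness-momo`: `InfBandedForm`, `LiouvilleShortDyadicBlocks`,
  `banded_of_compactness`.
-/

noncomputable section

open Finset Filter

namespace Summit.QuantumAdvantage.QuantumAdvantage.Cruxes.QuadraticDigitPhases.Ideator2

/-- The digit vector of `N` on `n` binary places, as `0/1 ∈ ZMod 2` (the crux's convention). -/
def digitVec (n N : ℕ) : Fin n → ZMod 2 := fun i => if Nat.testBit N i then 1 else 0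

/-- The phase `(-1)^{P(bits N)}` exactly as in the crux; for `N ≥ 2^n` it reads only the low `n`
bits, so `phase P` is automatically `2^n`-periodic. -/
def phase {n : ℕ} (P : MvPolynomial (Fin n) (ZMod 2)) (N : ℕ) : ℝ :=
  if MvPolynomial.eval (digitVec n N) P = 1 then -1 else 1

/-- The crux correlation `c_n(P) = Σ_{N<2^n} λ(N) (-1)^{P(bits N)}`. -/
def liouvilleCorr {n : ℕ} (P : MvPolynomial (Fin n) (ZMod 2)) : ℝ :=
  ∑ N ∈ range (2 ^ n), ((ArithmeticFunction.liouville N : ℤ) : ℝ) * phase P N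

/-- Sanity: the crux, restated through `liouvilleCorr` (definitional). -/
example : Theses.MobiusLadder.QuadraticDigitPhases ↔
    ∀ ε : ℝ, 0 < ε → ∀ᶠ n : ℕ in atTop, ∀ P : MvPolynomial (Fin n) (ZMod 2),
      P.totalDegree ≤ 2 → |liouvilleCorr P| ≤ ε * (2 : ℝ) ^ n := Iff.rfl

/-! ## Card 1 — carry-cocycle-katai -/

/-- **Dilation cocycle identity.** For odd `p`, the `j`-th bit of `p·M` is the `j`-th bit of `M`
XOR a carry bit that depends only on `M mod 2^j`: `π_p(M) = M ⊕ γ^p(M)` with `γ^p` strictly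
lower-triangular. (Elementary; to be proved.) -/
theorem testBit_mul_odd (p M j : ℕ) (hp : Odd p) :
    Nat.testBit (p * M) j = (Nat.testBit M j != Nat.testBit (p * (M % 2 ^ j)) j) := by
  sorry

/-- The Kátai–BSZ bilinear sum `Σ_{M<L} F(pM) F(qM)` for `F = (-1)^{P∘bits}` (incomplete when
`L < 2^n`; this is the hypothesis `hE` of the tree's effective BSZ estimate
`Literature.NumberTheory.Sieve.BourgainSarnakZiegler.norm_sum_le_of_goodN` at `N = 2^n - 1`). -/
def kbszSum {n : ℕ} (P : MvPolynomial (Fin n) (ZMod 2)) (p q L : ℕ) : ℝ :=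
  ∑ M ∈ range L, phase P (p * M) * phase P (q * M)

/-- `P` contains `r` degree-2 monomials `X_{a k} X_{b k}` whose `2r` endpoints are pairwise more
than `s` digit positions apart (an `s`-separated long-range matching in the monomial graph). -/
def HasSeparatedMatching {n : ℕ} (P : MvPolynomial (Fin n) (ZMod 2)) (r s : ℕ) : Prop :=
  ∃ a b : Fin r → Fin n,
    (∀ k, P.coeff (Finsupp.single (a k) 1 + Finsupp.single (b k) 1) ≠ 0) ∧
    (∀ k l, s < Nat.dist (a k) (b l)) ∧
    (∀ k l, k ≠ l → s < Nat.dist (a k) (a l) ∧ s < Nat.dist (b k) (b l))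

/-- **Conjectured decay lemma (deterministic, λ-free).** For every prime bound `B` and `τ > 0`
there are `r, s` such that every quadratic `P` with an `s`-separated matching of size `r`
satisfies the Kátai–BSZ hypothesis `|Σ_{M<L} F(pM)F(qM)| ≤ τ L` for all pairs of distinct odd
primes `p, q ≤ B` and all ranges `2^n/B ≤ L ≤ 2^n`. Mechanism: by `testBit_mul_odd`,
`F(pM)F(qM) = (-1)^{Mᵀ Ã (γ^p ⊕ γ^q)(M) + R(carries)}` — the quadratic part cancels and each
long-range edge of `Ã` couples an input bit to carry bits it cannot influence (free bits). -/
def LongRangeKbszDecay : Prop :=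
  ∀ B : ℕ, ∀ τ : ℝ, 0 < τ → ∃ r s : ℕ, ∀ n : ℕ, ∀ P : MvPolynomial (Fin n) (ZMod 2),
    P.totalDegree ≤ 2 → HasSeparatedMatching P r s →
    ∀ p q : ℕ, p.Prime → q.Prime → p ≠ q → Odd p → Odd q → p ≤ B → q ≤ B →
      ∀ L : ℕ, 2 ^ n ≤ B * L → L ≤ 2 ^ n → |kbszSum P p q L| ≤ τ * L

/-- **Long-range case of the crux** from the effective BSZ estimate (tree, proved) and the decay
lemma: for every `ε` there are `r, s` such that, for all large `n`, every quadratic `P` with an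
`s`-separated matching of size `r` has `|c_n(P)| ≤ ε 2^n`. -/
theorem longRange_case (h : LongRangeKbszDecay) :
    ∀ ε : ℝ, 0 < ε → ∃ r s : ℕ, ∀ᶠ n : ℕ in atTop, ∀ P : MvPolynomial (Fin n) (ZMod 2),
      P.totalDegree ≤ 2 → HasSeparatedMatching P r s → |liouvilleCorr P| ≤ ε * (2 : ℝ) ^ n := by
  sorry

/-- `P` is `s`-banded: every monomial's variables lie within `s` digit positions of each other
(degree-2 monomials `X_i X_j` need `|i-j| ≤ s`; linear and constant monomials are unrestricted). -/
def IsBanded {n : ℕ} (P : MvPolynomial (Fin n) (ZMod 2)) (s : ℕ) : Prop :=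
  ∀ m ∈ P.support, ∀ i ∈ m.support, ∀ j ∈ m.support, Nat.dist i j ≤ s

/-- The digit-LOCAL sub-crux: uniform Liouville-orthogonality of `s`-banded quadratic phases. -/
def BandedQuadraticDigitPhases (s : ℕ) : Prop :=
  ∀ ε : ℝ, 0 < ε → ∀ᶠ n : ℕ in atTop, ∀ P : MvPolynomial (Fin n) (ZMod 2),
    P.totalDegree ≤ 2 → IsBanded P s → |liouvilleCorr P| ≤ ε * (2 : ℝ) ^ n

/-- **Assembly of card 1** (combinatorial, provable now modulo its two hypotheses): a maximal
`s`-separated long-range matching either has size `≥ r` (long-range case) or its `s`-neighbourhood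
(`≤ 2r(2s+1)` variables) meets every long edge; fixing those variables (cylinders = averages of
`≤ 2^{2r(2s+1)}` Walsh characters, which only add linear terms) leaves an `s`-banded quadratic. -/
theorem crux_of_banded_and_longRange
    (hB : ∀ s : ℕ, BandedQuadraticDigitPhases s) (hL : LongRangeKbszDecay) :
    Theses.MobiusLadder.QuadraticDigitPhases := by
  sorry

/-! ## Card 2 — dyadic-block-bsz (scale transfer) -/

/-- Restriction of `P` to the low `L` digits: substitute `0` for `X_i`, `i ≥ L`. -/
def lowPart {n : ℕ} (L : ℕ) (P : MvPolynomial (Fin n) (ZMod 2)) : MvPolynomial (Fin n) (ZMod 2) :=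
  MvPolynomial.aeval (fun i : Fin n => if (i : ℕ) < L then MvPolynomial.X i else 0) P

/-- Walsh twist on the digits: `w_ξ(bits N)` with `ξ : Finset (Fin n)`. -/
def walshDigits {n : ℕ} (ξ : Finset (Fin n)) (N : ℕ) : ℝ :=
  Literature.Probability.RandomGraphs.LowDegree.walsh ξ (fun i : Fin n => Nat.testBit N i)

/-- **Cut inequality** (elementary, provable now): cutting the digit string at `L ≤ n`, the part
of `P` above the cut becomes a sign per block and the cross terms a block-dependent Walsh twist of
the low part, so `|c_n(P)| ≤ Σ_{b<2^{n-L}} max_ξ |Σ_{a<2^L} λ(2^L b + a) (-1)^{P_low(a)} w_ξ(a)|`. -/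
theorem cutBound {n : ℕ} (P : MvPolynomial (Fin n) (ZMod 2)) (hP : P.totalDegree ≤ 2)
    (L : ℕ) (hL : L ≤ n) :
    |liouvilleCorr P| ≤ ∑ b ∈ range (2 ^ (n - L)),
      (univ : Finset (Finset (Fin n))).sup' univ_nonempty (fun ξ =>
        |∑ a ∈ range (2 ^ L), ((ArithmeticFunction.liouville (2 ^ L * b + a) : ℤ) : ℝ) *
            phase (lowPart L P) a * walshDigits ξ a|) := by
  sorry

/-- `C⁺` of card 2: digital quadratic uniformity of `λ` in almost all dyadic blocks of length
`2^{L(n)}`, `L(n) = ⌊θ n⌋`, sup over all quadratic patterns INSIDE the sum over blocks. -/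
def DigitalUniformDyadicBlocks (θ : ℝ) : Prop :=
  ∀ ε : ℝ, 0 < ε → ∀ᶠ n : ℕ in atTop, ∀ P : MvPolynomial (Fin n) (ZMod 2), P.totalDegree ≤ 2 →
    ∑ b ∈ range (2 ^ (n - ⌊θ * n⌋₊)),
      (univ : Finset (Finset (Fin n))).sup' univ_nonempty (fun ξ =>
        |∑ a ∈ range (2 ^ ⌊θ * n⌋₊),
          ((ArithmeticFunction.liouville (2 ^ ⌊θ * n⌋₊ * b + a) : ℤ) : ℝ) *
            phase (lowPart ⌊θ * n⌋₊ P) a * walshDigits ξ a|) ≤ ε * (2 : ℝ) ^ n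

/-- **Scale transfer**: block uniformity at any one scale `θ ∈ (0,1]` gives the crux (immediate
from `cutBound`). The card's engine for `DigitalUniformDyadicBlocks θ` is Kátai–BSZ run ACROSS
blocks (Turán–Kubilius dilation covariance of the block family) with Matomäki–Radziwiłł for `λχ`
as the major-arc input and the deterministic dilation bounds of card 1 as the minor-arc input. -/
theorem crux_of_blockUniformity {θ : ℝ} (hθ : 0 < θ) (hθ1 : θ ≤ 1)
    (h : DigitalUniformDyadicBlocks θ) : Theses.MobiusLadder.QuadraticDigitPhases := by
  sorry

/-! ## Card 3 — banded-compactness-momo -/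

/-- An infinite `s`-banded quadratic form over `𝔽₂` with arbitrary linear part: the limit object
of a König subsequence of bad banded `P_n`. Its phase is a `2`-semimultiplicative sequence of gap
`≤ s` in the sense of `Literature.NumberTheory.LFunctions.IsSemimultiplicative` (Konieczny 2020). -/
structure InfBandedForm (s : ℕ) where
  quad : ℕ → ℕ → ZMod 2
  lin : ℕ → ZMod 2
  band : ∀ i j, quad i j ≠ 0 → i < j ∧ j ≤ i + s

/-- The `±1` phase `(-1)^{Q(bits N)}` of an infinite banded form (a finite sum: bits above
`Nat.size N` vanish). -/
def InfBandedForm.phase {s : ℕ} (Q : InfBandedForm s) (N : ℕ) : ℝ :=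
  let x : ℕ → ZMod 2 := fun i => if Nat.testBit N i then 1 else 0
  if (∑ i ∈ range (N + 1), ∑ j ∈ range (N + 1), Q.quad i j * x i * x j) +
      ∑ i ∈ range (N + 1), Q.lin i * x i = 1 then -1 else 1

/-- **Strong-MOMO-type property along dyadic blocks, relative to `λ`**, for ONE fixed sequence
`f`: for large block length `2^k`, `λ·f` has small mean on almost all aligned blocks of `[0,2^n)`,
uniformly as `n → ∞`. In print (via strong MOMO of the subshift, El Abdalaoui–Kułaga-Przymus–
Lemańczyk–de la Rue 2018 Thm 38 / Cor 40) for Kakutani sequences (= infinite Walsh characters),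
Thue–Morse and Rudin–Shapiro; `f ≡ 1` is Matomäki–Radziwiłł 2016. -/
def LiouvilleShortDyadicBlocks (f : ℕ → ℝ) : Prop :=
  ∀ ε : ℝ, 0 < ε → ∀ᶠ k : ℕ in atTop, ∀ᶠ n : ℕ in atTop,
    ∑ b ∈ range (2 ^ (n - k)),
      |∑ a ∈ range (2 ^ k), ((ArithmeticFunction.liouville (2 ^ k * b + a) : ℤ) : ℝ) *
        f (2 ^ k * b + a)| ≤ ε * (2 : ℝ) ^ n

/-- **Compactness reduction (card 3).** Uniformity over the finite `s`-banded family is automatic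
from the fixed-sequence block property: a bad sequence `P_n` has a König subsequence stabilising on
every initial digit segment to some `Q∞ : InfBandedForm s`; cutting at level `k` (the `s` digits
above the cut only add a top-digit Walsh twist, constant on sub-blocks of length `2^{k-s}`) bounds
`|c_n(P_n)|` by the `LiouvilleShortDyadicBlocks` sum of `Q∞.phase` at scale `k - s`. -/
theorem banded_of_compactness (s : ℕ)
    (h : ∀ Q : InfBandedForm s, LiouvilleShortDyadicBlocks Q.phase) :
    BandedQuadraticDigitPhases s := by
  sorry

/-- Cards 1 + 3 together: the whole crux from the λ-free decay lemma and the fixed-sequence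
block property of infinite banded phases. -/
theorem crux_of_decay_and_momo (hL : LongRangeKbszDecay)
    (hM : ∀ s : ℕ, ∀ Q : InfBandedForm s, LiouvilleShortDyadicBlocks Q.phase) :
    Theses.MobiusLadder.QuadraticDigitPhases :=
  crux_of_banded_and_longRange (fun s => banded_of_compactness s (hM s)) hL

end Summit.QuantumAdvantage.QuantumAdvantage.Cruxes.QuadraticDigitPhases.Ideator2

end
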